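import Summits.QuantumAdvantage.QuantumAdvantage.Theorems.WalkTwoStepFarLocalCriterionLeft
import Summits.QuantumAdvantage.QuantumAdvantage.Theorems.WalkTwoStepSparsePinned

/-!
# (G♯) local engine — toward `FarLocal p`, part 5: COUNTING — residue-class lower bounds and the five-block count (split to the right)

Cell qa-qnc0, rung (G♯) = item stmt-QuantumAdvantage-23121 (planner qa-qnc0-p2 g24, ask P2-24b); prover qn-prover-3 g15.

* `exists_residue_count_lower`: a constant `cZ = cZ(p) > 0` with `#{v ∈ {0,1}^d : |v| ≡ z (mod p)} ≥ cZ·2^d` for EVERY length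
  `d ≥ p − 1` and every residue `z` (`RungG.stub_equidist` at modulus `p` for long blocks, one explicit string for short ones) — this is
  where the clause `p ≤ s_g ≤ n − p` of `Far` enters;
* `exists_mod3p_count_lower`: for lengths `b ≥ L₁(p)`, every residue class mod `3p` has `≥ 2^b/(6p)` strings, and (Chinese remainder,
  `exists_crt_count_lower`) so has every pair (residue mod `3`, residue mod `p`);
* `count_right`: for a far cut with split to the right, in block coordinates `uX ++ corner ++ (uY ++ corner ++ uZ)`, the number of inputs
  of the class `w` whose discordance bit differs from that of their `ψ`-partner is `≥ 2^{|uX|}·(cZ 2^{|uZ|})·mY`: for every `uX` one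
  residue of `|uZ| (mod p)` (the split count of `g` at `a₀` when the mirror term is off, at `a₀ + 2` when it is on) and one residue of
  `|uY| (mod 3p)` (class constraint mod `p`, liveness flip mod `3`) satisfy the criteria of `WalkTwoStepFarLocalCriterion.lean`.
WHAT THIS IS NOT: the left-split count and the assembly of `FarLocal p` are the next file; separation NOT moved.
-/

namespace Summit.QuantumAdvantage.AdviceFreeQNC0.LocalEngine

open Finset Classical
open Summit.QuantumAdvantage.AdviceFreeQNC0.Coset21.RungG (classOf stub_equidist)

/-! ### Residue-class counts of binomial weights -/

section Counts

variable (p : ℕ) [Fact p.Prime]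

/-- **Uniform lower bound for residue classes mod `p`**, all lengths `≥ p − 1`. -/
theorem exists_residue_count_lower :
    ∃ cZ : ℝ, 0 < cZ ∧ ∀ d : ℕ, p - 1 ≤ d → ∀ z : ZMod p,
      cZ * (2 : ℝ) ^ d ≤ (((univ : Finset (Fin d → Bool)).filter fun v => ((wt v : ℕ) : ZMod p) = z).card : ℝ) := by
  haveI : NeZero p := ⟨(Fact.out : p.Prime).ne_zero⟩
  have hp2 : 2 ≤ p := (Fact.out : p.Prime).two_le
  have hp0 : (0 : ℝ) < p := by exact_mod_cast (Fact.out : p.Prime).pos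
  obtain ⟨ρ, hρ0, hρ1, hE⟩ := stub_equidist p hp2
  obtain ⟨L₀, hL₀⟩ := exists_pow_lt_of_lt_one (show (0 : ℝ) < 1 / (2 * p) by positivity) hρ1
  refine ⟨1 / (2 * p * 2 ^ L₀), by positivity, fun d hd z => ?_⟩
  by_cases hdL : L₀ ≤ d
  · -- long block: equidistribution
    have h := (abs_le.mp (hE d z)).1
    have hρd : ρ ^ d ≤ ρ ^ L₀ := pow_le_pow_of_le_one hρ0 hρ1.le hdL
    have h2d : (0 : ℝ) < (2 : ℝ) ^ d := by positivity
    have h1 : ρ ^ d * (2 : ℝ) ^ d ≤ 1 / (2 * p) * (2 : ℝ) ^ d :=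
      mul_le_mul_of_nonneg_right (hρd.trans hL₀.le) h2d.le
    have hL1 : (1 : ℝ) ≤ 2 ^ L₀ := one_le_pow₀ (by norm_num)
    have h3 : 1 / (2 * p * 2 ^ L₀) * (2 : ℝ) ^ d ≤ 1 / (2 * p) * (2 : ℝ) ^ d := by
      apply mul_le_mul_of_nonneg_right _ h2d.le
      rw [div_le_div_iff₀ (by positivity) (by positivity)]
      nlinarith
    have e : (2 : ℝ) ^ d / p - 1 / (2 * p) * (2 : ℝ) ^ d = 1 / (2 * p) * (2 : ℝ) ^ d := by field_simp; ring
    linarith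
  · -- short block: one explicit string of weight `z.val ≤ p − 1 ≤ d`
    push Not at hdL
    have hzv : z.val ≤ d := by have := ZMod.val_lt z; omega
    have hmem : (fun i : Fin d => decide (i.val < z.val)) ∈
        (univ : Finset (Fin d → Bool)).filter fun v => ((wt v : ℕ) : ZMod p) = z := by
      rw [Finset.mem_filter]
      exact ⟨Finset.mem_univ _, by rw [wt_indicator_lt hzv, ZMod.natCast_zmod_val]⟩
    have hcard : (1 : ℝ) ≤ (((univ : Finset (Fin d → Bool)).filter fun v => ((wt v : ℕ) : ZMod p) = z).card : ℝ) := by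
      exact_mod_cast Finset.card_pos.mpr ⟨_, hmem⟩
    have h2 : (2 : ℝ) ^ d ≤ 2 ^ L₀ := pow_le_pow_right₀ (by norm_num) hdL.le
    have h3 : 1 / (2 * p * 2 ^ L₀) * (2 : ℝ) ^ d ≤ 1 := by
      rw [div_mul_eq_mul_div, one_mul, div_le_one (by positivity)]
      have hL1 : (0 : ℝ) ≤ 2 ^ L₀ := by positivity
      have hp2' : (2 : ℝ) ≤ p := by exact_mod_cast hp2
      have hp1 : (1 : ℝ) ≤ 2 * p := by linarith
      have h4 : (2 : ℝ) ^ L₀ ≤ 2 * p * 2 ^ L₀ := le_mul_of_one_le_left hL1 hp1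
      linarith
    linarith

/-- **Lower bound for residue classes mod `3p`** on long blocks. -/
theorem exists_mod3p_count_lower {M : ℕ} (hM : M + 1 = 3 * p) :
    ∃ L₁ : ℕ, ∀ b : ℕ, L₁ ≤ b → ∀ t : ZMod (M + 1),
      (2 : ℝ) ^ b / (6 * p) ≤ (((univ : Finset (Fin b → Bool)).filter fun v => ((wt v : ℕ) : ZMod (M + 1)) = t).card : ℝ) := by
  have hp0 : (0 : ℝ) < p := by exact_mod_cast (Fact.out : p.Prime).pos
  obtain ⟨ρ, hρ0, hρ1, hE⟩ := stub_equidist (M + 1) (by omega)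
  obtain ⟨L₁, hL₁⟩ := exists_pow_lt_of_lt_one (show (0 : ℝ) < 1 / (6 * p) by positivity) hρ1
  refine ⟨L₁, fun b hb t => ?_⟩
  have h := (abs_le.mp (hE b t)).1
  have hρb : ρ ^ b ≤ ρ ^ L₁ := pow_le_pow_of_le_one hρ0 hρ1.le hb
  have h2b : (0 : ℝ) < (2 : ℝ) ^ b := by positivity
  have h1 : ρ ^ b * (2 : ℝ) ^ b ≤ 1 / (6 * p) * (2 : ℝ) ^ b := mul_le_mul_of_nonneg_right (hρb.trans hL₁.le) h2b.le
  have hM' : ((M + 1 : ℕ) : ℝ) = 3 * p := by rw [hM]; push_cast; ring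
  rw [hM'] at h
  have e : (2 : ℝ) ^ b / (3 * p) - 1 / (6 * p) * (2 : ℝ) ^ b = (2 : ℝ) ^ b / (6 * p) := by field_simp; ring
  linarith

/-- Chinese remainder: a residue mod `3p` whose strings have prescribed residues mod `3` and mod `p`. -/
theorem exists_crt_residue (hp5 : 5 ≤ p) {M : ℕ} (hM : M + 1 = 3 * p) (y₃ : ℕ) (yp : ZMod p) :
    ∃ t : ZMod (M + 1), ∀ Y : ℕ, ((Y : ℕ) : ZMod (M + 1)) = t → Y % 3 = y₃ % 3 ∧ ((Y : ℕ) : ZMod p) = yp := by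
  haveI : NeZero p := ⟨(Fact.out : p.Prime).ne_zero⟩
  have hcop : Nat.Coprime 3 p := by
    rw [Nat.coprime_primes (by norm_num) (Fact.out : p.Prime)]
    omega
  obtain ⟨k, hk3, hkp⟩ := Nat.chineseRemainder hcop y₃ yp.val
  refine ⟨((k : ℕ) : ZMod (M + 1)), fun Y hY => ?_⟩
  rw [ZMod.natCast_eq_natCast_iff, hM] at hY
  have h3 : Y ≡ k [MOD 3] := hY.of_mul_right p
  have hp' : Y ≡ k [MOD p] := hY.of_mul_left 3
  refine ⟨?_, ?_⟩
  · exact h3.trans hk3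
  · rw [(ZMod.natCast_eq_natCast_iff _ _ _).mpr (hp'.trans hkp), ZMod.natCast_zmod_val]

/-- **Lower bound for the pair (residue mod `3`, residue mod `p`)** on long blocks. -/
theorem exists_crt_count_lower (hp5 : 5 ≤ p) :
    ∃ L₁ : ℕ, ∀ b : ℕ, L₁ ≤ b → ∀ (y₃ : ℕ) (yp : ZMod p),
      (2 : ℝ) ^ b / (6 * p) ≤ (((univ : Finset (Fin b → Bool)).filter fun v =>
        wt v % 3 = y₃ % 3 ∧ ((wt v : ℕ) : ZMod p) = yp).card : ℝ) := by
  have hM : 3 * p - 1 + 1 = 3 * p := by omega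
  obtain ⟨L₁, hL₁⟩ := exists_mod3p_count_lower p hM
  refine ⟨L₁, fun b hb y₃ yp => ?_⟩
  obtain ⟨t, ht⟩ := exists_crt_residue p hp5 hM y₃ yp
  refine (hL₁ b hb t).trans ?_
  exact_mod_cast Finset.card_le_card fun v hv => by
    rw [Finset.mem_filter] at hv ⊢
    exact ⟨hv.1, ht (wt v) hv.2⟩

end Counts

/-! ### The five-block count, split to the right -/

section CountRight

variable {p : ℕ} [Fact p.Prime] {a b d : ℕ}

/-- **Counting lemma, split to the right.**  See the module docstring. -/
theorem count_right (hp5 : 5 ≤ p) (c : ℕ) (S : TwoStep p (a + 2 + (b + 2 + d))) (w : ZMod p)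
    (g h₂ : Fin (a + 2 + (b + 2 + d) + 1)) (hg : g.val = a + 1) (hh₂ : h₂.val = a + 2 + (b + 1))
    (hsplit : S.s g = h₂.val) (hαβ : S.α g ≠ S.β g)
    (cZ : ℝ) (hcZ : ∀ z : ZMod p,
      cZ * (2 : ℝ) ^ d ≤ (((univ : Finset (Fin d → Bool)).filter fun uZ => ((wt uZ : ℕ) : ZMod p) = z).card : ℝ))
    (mY : ℝ) (hmY0 : 0 ≤ mY) (hmY : ∀ (y₃ : ℕ) (yp : ZMod p),
      mY ≤ (((univ : Finset (Fin b → Bool)).filter fun uY => wt uY % 3 = y₃ % 3 ∧ ((wt uY : ℕ) : ZMod p) = yp).card : ℝ)) :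
    (2 : ℝ) ^ a * (cZ * (2 : ℝ) ^ d) * mY ≤ (((classOf p w : Finset (Fin (a + 2 + (b + 2 + d)) → Bool)).filter fun u =>
        discBit c S g.val u ≠ discBit c S g.val (cornerFlip (a + 2 + (b + 2 + d)) h₂.val u)).card : ℝ) := by
  haveI : NeZero p := ⟨(Fact.out : p.Prime).ne_zero⟩
  -- the predicate counted
  set P : (Fin (a + 2 + (b + 2 + d)) → Bool) → Prop := fun u =>
    ((wt u : ℕ) : ZMod p) = w ∧ discBit c S g.val u ≠ discBit c S g.val (cornerFlip (a + 2 + (b + 2 + d)) h₂.val u) with hP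
  have hcardP : ((classOf p w : Finset (Fin (a + 2 + (b + 2 + d)) → Bool)).filter fun u =>
      discBit c S g.val u ≠ discBit c S g.val (cornerFlip (a + 2 + (b + 2 + d)) h₂.val u)) = univ.filter P := by
    unfold Coset21.RungG.classOf
    rw [Finset.filter_filter]
  -- the specification of the good triples `(uX, uY, uZ)` (both corners of type `false`)
  set δ : ZMod p := S.α g - S.β g with hδ
  have hδ0 : δ ≠ 0 := sub_ne_zero.mpr hαβ
  set c₂ : (Fin a → Bool) → Prop := fun uX =>
    S.s h₂ = a + 1 ∧ fireAt S h₂ w ((wt uX : ℕ) : ZMod p) ≠ fireAt S h₂ w (((wt uX + 1 : ℕ)) : ZMod p) with hc₂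
  set eX : (Fin a → Bool) → ZMod p := fun uX => if c₂ uX then 2 else 0 with heX
  set zStar : (Fin a → Bool) → ZMod p := fun uX => w - 1 - (S.r g + eX uX * δ - S.β g * w) * δ⁻¹ with hzStar
  set Zspec : (Fin a → Bool) → (Fin d → Bool) → Prop := fun uX uZ => ((wt uZ : ℕ) : ZMod p) = zStar uX with hZspec
  set y₃ : (Fin a → Bool) → (Fin d → Bool) → ℕ := fun uX uZ =>
    if c₂ uX then c + a + b + 2 * wt uX + wt uZ + 6 else 2 * (c + a + 2 * wt uX + wt uZ + 3) with hy₃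
  set Yspec : (Fin a → Bool) → (Fin d → Bool) → (Fin b → Bool) → Prop := fun uX uZ uY =>
    wt uY % 3 = y₃ uX uZ % 3 ∧ ((wt uY : ℕ) : ZMod p) = w - 2 - ((wt uX : ℕ) : ZMod p) - ((wt uZ : ℕ) : ZMod p) with hYspec
  -- (1) good triples give counted inputs
  have hgood : ∀ uX uZ uY, Zspec uX uZ → Yspec uX uZ uY → P (blockInput uX false uY false uZ) := by
    intro uX uZ uY hZ hY
    simp only [hZspec, hYspec, hzStar] at hZ hY
    obtain ⟨hY3, hYp⟩ := hY
    -- the class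
    have hW : (((wt uX + 1 + (wt uY + 1 + wt uZ) : ℕ)) : ZMod p) = w := by
      push_cast; rw [hYp]; ring
    have hN : (((wt uX + 1 + (wt uY + false.toNat) : ℕ)) : ZMod p) = w - 1 - ((wt uZ : ℕ) : ZMod p) := by
      simp only [Bool.toNat_false, add_zero]; push_cast; rw [hYp]; ring
    -- the split-count relation: `(α−β)·N(s) + β·W = r + e·(α−β)`
    have hrel : (S.α g - S.β g) * (w - 1 - ((wt uZ : ℕ) : ZMod p)) + S.β g * w = S.r g + eX uX * (S.α g - S.β g) := by
      rw [hZ, ← hδ]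
      have : δ * ((S.r g + eX uX * δ - S.β g * w) * δ⁻¹) = S.r g + eX uX * δ - S.β g * w := by
        rw [mul_comm, mul_assoc, inv_mul_cancel₀ hδ0, mul_one]
      linear_combination this
    refine ⟨by rw [wt_blockInput]; exact hW, ?_⟩
    by_cases hc : c₂ uX
    · -- mirror term on: split count at `a₀ + 2`
      have he : eX uX = 2 := by simp only [heX, if_pos hc]
      have hy : y₃ uX uZ = c + a + b + 2 * wt uX + wt uZ + 6 := by simp only [hy₃, if_pos hc]
      obtain ⟨hc1, hc2⟩ := hc
      refine discBit_ne_right_mirror hp5 c S g h₂ hg hh₂ hsplit hαβ uX false uY false uZ ?_ hc1 ?_ ?_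
      · rw [hN, hW]; rw [he] at hrel; exact hrel
      · rw [hW]; exact hc2
      · rw [hy] at hY3; omega
    · -- mirror term off: `g` fires, its liveness flips
      have he : eX uX = 0 := by simp only [heX, if_neg hc]
      have hy : y₃ uX uZ = 2 * (c + a + 2 * wt uX + wt uZ + 3) := by simp only [hy₃, if_neg hc]
      refine discBit_ne_right_main c S g h₂ hg hh₂ hsplit hαβ uX false uY false uZ ?_ ?_ ?_
      · unfold fireAt
        rw [decide_eq_true_eq, hN, hW]
        rw [he, zero_mul, add_zero] at hrel
        linear_combination hrel
      · rw [hy] at hY3; omega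
      · rw [hW]; exact hc
  -- (2) the count of inputs dominates the number of good triples
  have hstep : ∑ uX : Fin a → Bool, ∑ uY : Fin b → Bool, ∑ uZ : Fin d → Bool,
      (if Zspec uX uZ ∧ Yspec uX uZ uY then 1 else 0) ≤ (univ.filter P).card := by
    rw [Finset.card_filter, sum_glue3]
    refine Finset.sum_le_sum fun uX _ => ?_
    -- inner: `Σ_R Σ_κ [P (glue3 uX κ R)] ≥ Σ_R [P (glue3 uX (corner false) R)]`
    have h1 : ∑ R : Fin (b + 2 + d) → Bool, (if P (glue3 uX (corner false) R) then 1 else 0)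
        ≤ ∑ R : Fin (b + 2 + d) → Bool, ∑ κ : Fin 2 → Bool, (if P (glue3 uX κ R) then 1 else 0) :=
      Finset.sum_le_sum fun R _ => Finset.single_le_sum (f := fun κ : Fin 2 → Bool => if P (glue3 uX κ R) then 1 else 0)
        (fun _ _ => Nat.zero_le _) (Finset.mem_univ (corner false))
    refine le_trans ?_ h1
    rw [sum_glue3]
    refine Finset.sum_le_sum fun uY _ => ?_
    refine Finset.sum_le_sum fun uZ _ => ?_
    have h2 : (if P (glue3 uX (corner false) (glue3 uY (corner false) uZ)) then 1 else 0)
        ≤ ∑ κ' : Fin 2 → Bool, (if P (glue3 uX (corner false) (glue3 uY κ' uZ)) then 1 else 0) :=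
      Finset.single_le_sum (f := fun κ' : Fin 2 → Bool => if P (glue3 uX (corner false) (glue3 uY κ' uZ)) then 1 else 0)
        (fun _ _ => Nat.zero_le _) (Finset.mem_univ (corner false))
    refine le_trans ?_ h2
    by_cases hs : Zspec uX uZ ∧ Yspec uX uZ uY
    · have hPu : P (glue3 uX (corner false) (glue3 uY (corner false) uZ)) := hgood uX uZ uY hs.1 hs.2
      rw [if_pos hs, if_pos hPu]
    · rw [if_neg hs]; exact Nat.zero_le _
  -- (3) evaluate the number of good triples
  have hZcount : ∀ uX : Fin a → Bool,
      cZ * (2 : ℝ) ^ d * mY ≤ ∑ uY : Fin b → Bool, ∑ uZ : Fin d → Bool,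
        (if Zspec uX uZ ∧ Yspec uX uZ uY then (1 : ℝ) else 0) := by
    intro uX
    rw [Finset.sum_comm]
    have h1 : ∀ uZ : Fin d → Bool, (if Zspec uX uZ then mY else 0)
        ≤ ∑ uY : Fin b → Bool, (if Zspec uX uZ ∧ Yspec uX uZ uY then (1 : ℝ) else 0) := by
      intro uZ
      by_cases hZ : Zspec uX uZ
      · rw [if_pos hZ]
        have e : ∑ uY : Fin b → Bool, (if Zspec uX uZ ∧ Yspec uX uZ uY then (1 : ℝ) else 0)
            = (((univ : Finset (Fin b → Bool)).filter fun uY => Yspec uX uZ uY).card : ℝ) := by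
          rw [Finset.card_filter]; push_cast
          exact Finset.sum_congr rfl fun uY _ => by simp [hZ]
        rw [e]
        exact hmY (y₃ uX uZ) _
      · rw [if_neg hZ]
        exact Finset.sum_nonneg fun uY _ => by rw [if_neg (fun h => hZ h.1)]
    refine le_trans ?_ (Finset.sum_le_sum fun uZ _ => h1 uZ)
    rw [← Finset.sum_filter, Finset.sum_const, nsmul_eq_mul]
    have h2 := hcZ (zStar uX)
    have e : ((univ : Finset (Fin d → Bool)).filter fun uZ => Zspec uX uZ)
        = (univ : Finset (Fin d → Bool)).filter fun uZ => ((wt uZ : ℕ) : ZMod p) = zStar uX := by rfl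
    rw [e]
    nlinarith
  have htotal : (2 : ℝ) ^ a * (cZ * (2 : ℝ) ^ d) * mY ≤ ∑ uX : Fin a → Bool, ∑ uY : Fin b → Bool, ∑ uZ : Fin d → Bool,
      (if Zspec uX uZ ∧ Yspec uX uZ uY then (1 : ℝ) else 0) := by
    have e : (2 : ℝ) ^ a * (cZ * (2 : ℝ) ^ d) * mY = ∑ _uX : Fin a → Bool, cZ * (2 : ℝ) ^ d * mY := by
      rw [Finset.sum_const, Finset.card_univ, Fintype.card_fun, Fintype.card_bool, Fintype.card_fin, nsmul_eq_mul]
      push_cast; ring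
    rw [e]
    exact Finset.sum_le_sum fun uX _ => hZcount uX
  -- (4) conclude
  rw [hcardP]
  refine htotal.trans ?_
  have := hstep
  exact_mod_cast this

end CountRight

end Summit.QuantumAdvantage.AdviceFreeQNC0.LocalEngine
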